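import Summits.RiemannHypothesis.RiemannHypothesis.Theses.LeeYang
import Summits.RiemannHypothesis.RiemannHypothesis.Theorems.LeeYangLeeyangCumulantAlternationXiSeries
import Summits.RiemannHypothesis.RiemannHypothesis.Theorems.LeeYangLeeyangCumulantAlternationXiZeros
import HarnessLib

/-!
# RiemannHypothesis / LeeYang — `LeeyangCumulantAlternationXi` (item `stmt-RiemannHypothesis-0456`)

**Theorem** (`leeyangCumulantAlternationXi_proof`, unconditional):
`0 < (−1)^{n+1} (d/dσ)^{2n} log ‖ξ(σ)‖ |_{σ=½}` for every `n ≥ 1` — the even Taylor coefficients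
of `log ξ` at the centre alternate in sign (the cumulants `κ_{2n}` of the de Bruijn law `Φ du/∫Φ`
alternate: `κ₂ > 0`, `κ₄ < 0`, …; Lebowitz's inequality at `n = 2`, Newman 1975 Thm 3 under
Lee–Yang).  Proof:

1. (`…Series.lean`) for a Hadamard sequence `b` of `H₀`,
   `(log|ξ|)^{(2n)}(½) = −(2n)!·4ⁿ/n · Re ∑ₖ bₖⁿ`, so the claim is `Pₙ := Re ∑ₖ (−bₖ)ⁿ > 0`;
2. (`…Zeros.lean`) the non-zero `−bₖ = −1/(2ρₖ−1)²` over the pairs `{ρₖ, 1−ρₖ}` of non-trivial zeros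
   of `ζ`; one of them is the first zero, `−b_{k₁} = 1/(4γ₁²)`, `γ₁ ∈ [225/16, 227/16]`; every `ρₖ`
   with `|Im ρₖ| ≤ 101` is on the critical line (`(−bₖ)ⁿ = (4γₖ²)⁻ⁿ ≥ 0`), and for the others
   `|bₖ|ⁿ ≤ (4·101²)^{−(n−1)} |bₖ| ≤ (4·101²)^{−(n−1)} Re 1/(ρₖ(1−ρₖ))` with
   `∑ₖ Re 1/(ρₖ(1−ρₖ)) = ξ'/ξ(1) = β/2 < 0.0237` (`β = nicolasBeta`);
3. (here) hence `Pₙ ≥ (4γ₁²)⁻ⁿ − (4·101²)^{−(n−1)} β/2 > 0` for `n ≥ 2`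
   (`(1/806)² > 0.0237/(4·101²)`), and `P₁ ≥ 1/(4γ₁²) > 0` since every `Re(−bₖ) ≥ 0`.
-/

noncomputable section

namespace Summit.RiemannHypothesis.LeeYang

open Complex Literature.NumberTheory.LFunctions
open scoped Nat

variable {b : ℕ → ℂ}

/-- Pointwise, `n = 1`: `Re(−bₖ) ≥ 0` for every `k` (`Re (2ρ−1)² < 0` in the strip). -/
theorem re_neg_nonneg (hb : IsHadamardSeq 0 b) (k : ℕ) : 0 ≤ (-b k).re := by
  rcases eq_or_ne (b k) 0 with hk | hk
  · simp [hk]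
  obtain ⟨-, h0, h1, hγ, hbk⟩ := xiZero_spec hb hk
  rw [hbk]
  exact re_neg_one_div_sq_nonneg h0 h1 hγ

/-- Pointwise, all `n ≥ 1`: `Re (−bₖ)ⁿ ≥ −(4·101²)^{−(n−1)} · Re(−4bₖ/(1−bₖ))` for every `k`
(on-line zeros contribute `≥ 0`; the others have `|Im ρₖ| > 101`). -/
theorem re_neg_pow_ge (hb : IsHadamardSeq 0 b) {n : ℕ} (hn : 1 ≤ n) (k : ℕ) :
    -((1 / (4 * 101 ^ 2) : ℝ) ^ (n - 1) * (-(4 * b k) / (1 - b k)).re) ≤ ((-b k) ^ n).re := by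
  obtain ⟨ht0, hbt⟩ := norm_le_re_term hb k
  have hc0 : (0 : ℝ) ≤ (1 / (4 * 101 ^ 2) : ℝ) ^ (n - 1) := by positivity
  rcases eq_or_ne (b k) 0 with hk | hk
  · have hn0 : n ≠ 0 := by omega
    simp [hk, hn0]
  obtain ⟨hz, h0, h1, hγ, hbk⟩ := xiZero_spec hb hk
  have him : (IsHadamardSeq.xiZero b k).im ≠ 0 := by
    intro h
    rw [h, abs_zero] at hγ
    norm_num at hγ
  by_cases hT : |(IsHadamardSeq.xiZero b k).im| ≤ 101
  · -- on the critical line: `(−bₖ)ⁿ = (4γ²)⁻ⁿ ≥ 0`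
    have hre := re_eq_half_of_abs_im_le hz h0 h1 hT
    have e : -b k = ((1 / (4 * (IsHadamardSeq.xiZero b k).im ^ 2) : ℝ) : ℂ) := by
      rw [hbk, one_div_sq_of_re_eq_half hre him]
      push_cast
      ring
    rw [e, ← ofReal_pow, ofReal_re]
    have h2 : 0 ≤ (1 / (4 * (IsHadamardSeq.xiZero b k).im ^ 2)) ^ n := by positivity
    nlinarith [mul_nonneg hc0 ht0]
  · -- far from the real axis: `|bₖ| ≤ 1/(4·101²)`
    rw [not_le] at hT
    have hnb : ‖b k‖ ≤ 1 / (4 * 101 ^ 2) := by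
      rw [hbk]
      refine (norm_one_div_sq_le him).trans ?_
      have h101 : (101 : ℝ) ^ 2 ≤ (IsHadamardSeq.xiZero b k).im ^ 2 := by
        have h := sq_abs (IsHadamardSeq.xiZero b k).im
        nlinarith [abs_nonneg (IsHadamardSeq.xiZero b k).im]
      exact one_div_le_one_div_of_le (by positivity) (by linarith)
    have h3 : ‖b k‖ ^ n ≤ (1 / (4 * 101 ^ 2)) ^ (n - 1) * ‖b k‖ := by
      rw [← Nat.sub_add_cancel hn, pow_succ, Nat.add_sub_cancel]
      gcongr
    have h4 : (1 / (4 * 101 ^ 2) : ℝ) ^ (n - 1) * ‖b k‖ ≤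
        (1 / (4 * 101 ^ 2) : ℝ) ^ (n - 1) * (-(4 * b k) / (1 - b k)).re :=
      mul_le_mul_of_nonneg_left hbt hc0
    have h5 : -‖(-b k) ^ n‖ ≤ ((-b k) ^ n).re := neg_le_of_abs_le (abs_re_le_norm _)
    rw [norm_pow, norm_neg] at h5
    linarith

/-- The arithmetic of the final comparison: for `n ≥ 2`, `0 < γ ≤ 227/16`, `β < 0.0474`,
`(4·101²)^{−(n−1)} β/2 < (4γ²)⁻ⁿ`. -/
theorem tail_lt_first_term {γ β : ℝ} (hγ0 : 0 < γ) (hγ : γ ≤ 227 / 16) (hβ : β < 0.0474) {n : ℕ}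
    (hn : 2 ≤ n) : (1 / (4 * (101 : ℝ) ^ 2)) ^ (n - 1) * (β / 2) < (1 / (4 * γ ^ 2)) ^ n := by
  obtain ⟨m, rfl⟩ : ∃ m, n = m + 2 := ⟨n - 2, by omega⟩
  rw [show m + 2 - 1 = m + 1 by omega]
  have hγ2 : 4 * γ ^ 2 ≤ 806 := by nlinarith
  have hu : (1 / 806 : ℝ) ≤ 1 / (4 * γ ^ 2) := one_div_le_one_div_of_le (by positivity) hγ2
  have hv : 1 / (4 * (101 : ℝ) ^ 2) ≤ 1 / (4 * γ ^ 2) :=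
    one_div_le_one_div_of_le (by positivity) (by nlinarith)
  have hvm : (0 : ℝ) < (1 / (4 * (101 : ℝ) ^ 2)) ^ m := by positivity
  calc (1 / (4 * (101 : ℝ) ^ 2)) ^ (m + 1) * (β / 2)
      = (1 / (4 * (101 : ℝ) ^ 2)) * (β / 2) * (1 / (4 * (101 : ℝ) ^ 2)) ^ m := by ring
    _ ≤ (1 / (4 * (101 : ℝ) ^ 2)) * (0.0474 / 2) * (1 / (4 * (101 : ℝ) ^ 2)) ^ m := by
        gcongr
    _ < (1 / 806) ^ 2 * (1 / (4 * (101 : ℝ) ^ 2)) ^ m := by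
        have h : (1 / (4 * (101 : ℝ) ^ 2)) * (0.0474 / 2) < (1 / 806) ^ 2 := by norm_num
        exact mul_lt_mul_of_pos_right h hvm
    _ ≤ (1 / (4 * γ ^ 2)) ^ 2 * (1 / (4 * γ ^ 2)) ^ m := by gcongr
    _ = (1 / (4 * γ ^ 2)) ^ (m + 2) := by ring

/-- **`Pₙ = Re ∑ₖ (−bₖ)ⁿ > 0`** for every Hadamard sequence `b` of `H₀` and every `n ≥ 1`. -/
theorem re_tsum_neg_pow_pos (hb : IsHadamardSeq 0 b) {n : ℕ} (hn : 1 ≤ n) :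
    0 < (∑' k, (-b k) ^ n).re := by
  obtain ⟨k₁, γ, hγ1, hγ2, hk₁⟩ := exists_index_first_zero hb
  have hγ0 : 0 < γ := by linarith
  -- summability and the `k₁` term
  have hs : Summable fun k ↦ (-b k) ^ n := by
    have h := ((summable_pow_and_norm_tsum_pow_le hb hn).1).mul_left ((-1) ^ n)
    exact h.congr fun k ↦ (neg_pow (b k) n).symm
  rw [Complex.re_tsum hs]
  have hf : HasSum (fun k ↦ ((-b k) ^ n).re) (∑' k, ((-b k) ^ n).re) := (Complex.hasSum_re hs.hasSum).summable.hasSum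
  have hk₁v : ((-b k₁) ^ n).re = (1 / (4 * γ ^ 2)) ^ n := by
    rw [hk₁, ofReal_neg, neg_neg, ← ofReal_pow, ofReal_re]
  -- the comparison family `g k = [k = k₁]·(−b_{k₁})ⁿ − c · Re(−4bₖ/(1−bₖ))`
  obtain ⟨c, hc⟩ : ∃ c : ℝ, c = if n = 1 then 0 else (1 / (4 * (101 : ℝ) ^ 2)) ^ (n - 1) :=
    ⟨_, rfl⟩
  have hc0 : 0 ≤ c := by rw [hc]; split_ifs <;> positivity
  have hg : HasSum (fun k ↦ (if k = k₁ then ((-b k₁) ^ n).re else 0) - c * (-(4 * b k) / (1 - b k)).re)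
      (((-b k₁) ^ n).re - c * (nicolasBeta / 2)) :=
    (hasSum_ite_eq k₁ _).sub ((hasSum_re_terms_one hb).mul_left c)
  have hle : ∀ k, (if k = k₁ then ((-b k₁) ^ n).re else 0) - c * (-(4 * b k) / (1 - b k)).re ≤
      ((-b k) ^ n).re := by
    intro k
    obtain ⟨ht0, -⟩ := norm_le_re_term hb k
    have hct : 0 ≤ c * (-(4 * b k) / (1 - b k)).re := mul_nonneg hc0 ht0
    split_ifs with hk
    · subst hk
      linarith
    · rw [zero_sub]
      rw [hc]
      split_ifs with hn1
      · subst hn1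
        rw [zero_mul, neg_zero, pow_one]
        exact re_neg_nonneg hb k
      · exact re_neg_pow_ge hb hn k
  have hmain := hasSum_le hle hg hf
  refine lt_of_lt_of_le ?_ hmain
  rw [hk₁v, hc]
  split_ifs with hn1
  · rw [zero_mul, sub_zero]
    positivity
  · have hn2 : 2 ≤ n := by omega
    have h := tail_lt_first_term hγ0 hγ2 nicolasBeta_lt' hn2
    linarith

/-- **Item `stmt-RiemannHypothesis-0456` (`LeeyangCumulantAlternationXi`), proved unconditionally**:
for every `n ≥ 1`, `0 < (−1)^{n+1} · (d/dσ)^{2n} log ‖ξ(σ)‖ |_{σ = ½}`. -/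
theorem leeyangCumulantAlternationXi_proof :
    Summit.RiemannHypothesis.RiemannHypothesis.Theses.LeeYang.LeeyangCumulantAlternationXi := by
  intro n hn
  obtain ⟨b, hb⟩ := exists_isHadamardSeq 0
  rw [iteratedDeriv_log_norm_riemannXi_one_half hb hn]
  have hP := re_tsum_neg_pow_pos hb hn
  have e : (∑' k, (-b k) ^ n).re = (-1) ^ n * (∑' k, b k ^ n).re := by
    have h1 : (fun k ↦ (-b k) ^ n) = fun k ↦ (-1) ^ n * b k ^ n := funext fun k ↦ neg_pow _ _
    rw [h1, tsum_mul_left, show ((-1 : ℂ) ^ n) = (((-1 : ℝ) ^ n : ℝ) : ℂ) by push_cast; ring,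
      re_ofReal_mul]
  have hn0 : (0 : ℝ) < n := by exact_mod_cast hn
  have hC : (0 : ℝ) < (2 * n)! * 4 ^ n / n := div_pos (by positivity) hn0
  calc (0 : ℝ) < ((2 * n)! * 4 ^ n / n) * (∑' k, (-b k) ^ n).re := mul_pos hC hP
    _ = (-1) ^ (n + 1) * (-((2 * n)! * (4 : ℝ) ^ n / n) * (∑' k, b k ^ n).re) := by
        rw [e]
        ring

end Summit.RiemannHypothesis.LeeYang
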